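import Summits.BirchSwinnertonDyer.BirchSwinnertonDyer.Theorems.Rank2Observatory2DescClCurveCertDLogs
import Summits.BirchSwinnertonDyer.BirchSwinnertonDyer.Theorems.Rank2Observatory2DescClRowCertLe
import HarnessLib

/-!
# BirchSwinnertonDyer — rank ≥ 2 observatory: KERNEL-2DESC-CL ΩD — the per-curve certificate over a dyadic-root-view field record, part 6/7: the main theorem

HONEST FRAMING: per-curve certified theorems and census instruments; no claim on BSD in rank ≥ 2.

Part 6 of 7.  **Soundness of the dyadic-root-view per-curve `r`-checker with a kill list in validity form,
`rank_le_of_checkCD`**: the abstract strict-count cover-set theorem `mordellWeilRank_le_of_coverSet_cl_lt`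
(`…2DescClRowCertLe`) applied to the genuine `𝓞 K` elements `eltD` of the certificate (`ω`-elements
`W₀ + W₁α + W₂ω`), with `M = D · q₁q₂` (class-group generation from part 2, `closure_q2_eq_top_of_coreD`: the
dyadic class certificates + the `α`-rows), the three ROOTED PRIMES above `2` obtained from the Hensel certificates
(`nonempty_rooted₁/₂/₃`), support `T = {W₁₁r, W₁₂r, W₂₁r, W₂₂r} ∪` tagged code primes (`α`-codes and dyadic
primes), FOUR valuation-parity rows, the parity certificate on `#chars + 5` rows, and the killed classes
discharged by `admKillsV_sound` (`…2DescKillValid`) after rescaling the 2-descent relation by the square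
`M^{#U+1} = (r₁^{#U+1})²` (the kill quadrics are read on the `α`-coordinates `X = Mx`).  Proof text = E2Q2 part 7
(`rank_le_of_checkE2Q`) with the `ω`-presentation and the dyadic support branch.  Then `rank_eq_of_checkCD`.
New declarations only; sorry-free; axioms `propext`, `Classical.choice`, `Quot.sound`.
[cite: Cassels1991LecturesEllipticCurves, §15] [cite: CremonaAlgorithms1997, §3.6] [cite: Cohen1993, §4.8.2, §6.1, §6.5]
[cite: SilvermanAEC2009, X.1.1] [cite: Cassels1986, Ch. 4 (Hensel's lemma)]
-/

set_option linter.dupNamespace false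

noncomputable section

open scoped Classical NumberField nonZeroDivisors

open Literature.NumberTheory.NumberFields Polynomial Module NumberField IsDedekindDomain Ideal

namespace Summit.BirchSwinnertonDyer.BirchSwinnertonDyer.Rank2Observatory.TwoDescCl

open TwoDescCubic ClFieldCertQ2 TwoDescKill TwoDescPadic

section Sound

variable {K : Type*} [Field K] [NumberField K] {θ : K}

/-- **Soundness of the dyadic-root-view two-prime per-curve checker with kills: `rank E(ℚ) ≤ r`.**
[cite: Cassels1991LecturesEllipticCurves, §15] [cite: CremonaAlgorithms1997, §3.6] -/
theorem rank_le_of_checkCD (r : ℕ) (F : ClFieldCertDc)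
    (hθ : aeval θ (MonicCubic.poly F.fd.base.a F.fd.base.b F.fd.base.c) = 0) (h3 : finrank ℚ K = 3)
    (h2 : F.check2 = true) (hpr : F.fd.base.primeList.Forall Nat.Prime) (cc : ClCurveCertD) (ks : List ClKill)
    (hc : checkCD F cc r ks = true) (hk : KillValidCD F cc ks) :
    ((⟨0, cc.A, 0, cc.B, cc.C⟩ : WeierstrassCurve ℚ)).mordellWeilRank ≤ r := by
  classical
  have hK := F.const_of_check2 h2
  have hDD := F.checkD_of_check2 h2
  have hD := F.fd.checkCoreD_of_checkD hDD
  have hfd := F.fd.checkField_of_checkD hDD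
  have hR := F.fd.checkReg_of_coreD hD
  have hirr := F.fd.base.irreducible_of_reg hR
  obtain ⟨R₁⟩ := F.fd.nonempty_rooted₁ hθ h3 hD
  obtain ⟨R₂⟩ := F.fd.nonempty_rooted₂ hθ h3 hD
  obtain ⟨R₃⟩ := F.fd.nonempty_rooted₃ hθ h3 hD
  have h0 := (F.fd.base.interval_of_field hfd).1
  have hq₁ := F.fd.base.q₁_prime hpr
  have hq₂ := F.fd.base.q₂_prime hpr
  simp only [checkCD, Bool.and_eq_true, decide_eq_true_eq, List.all_eq_true] at hc
  obtain ⟨⟨⟨⟨⟨⟨⟨⟨⟨⟨⟨⟨⟨⟨⟨⟨⟨⟨⟨⟨hΔ, hirrF⟩, hcub⟩, hder⟩, hovX⟩, hovD⟩, hdisc⟩, hND0⟩, hdn⟩, hdnC⟩, hcodes⟩,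
    hdW11⟩, hdW12⟩, hdW21⟩, hdW22⟩, hQ⟩, hhead⟩, hfamAll⟩, hcert⟩, hlite⟩, hcount⟩ := hc
  haveI hEl := isElliptic_of_deltaShort_ne hΔ
  have hirrF' := irreducible_of_noRootMod hirrF
  have hMK : (F.M : K) ≠ 0 := M_ne_zero_KD hK
  have hMO : (F.M : 𝓞 K) ≠ 0 := M_ne_zero_OD hK
  -- `θ_E = e₀`, root of `F`
  have hXe := M_mul_eltD_coe hθ hD hovX
  have haevX := aeval_lin_eq_zero_of_coords hθ cc.Xt hcub
  have haev : aeval (algebraMap (𝓞 K) K (eltD F hθ hD cc.Wt)) (MonicCubic.poly cc.A cc.B cc.C) = 0 := by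
    rw [← hXe] at haevX
    simp only [MonicCubic.poly, map_add, map_mul, map_pow, aeval_X, eq_intCast, map_intCast, map_natCast]
      at haevX ⊢
    have h3' : (F.M : K) ^ 3 ≠ 0 := pow_ne_zero 3 hMK
    apply mul_right_injective₀ h3'
    simp only [mul_zero]
    linear_combination haevX
  -- `D₀ = F′(e₀)`
  have hderX := deriv_eq_of_coords hθ cc.Xt (smulCoords (F.M : ℤ) cc.XD) [] hder
  have hderiv : (3 : 𝓞 K) * (eltD F hθ hD cc.Wt) ^ 2 +
      2 * ((cc.A : ℤ) : 𝓞 K) * (eltD F hθ hD cc.Wt) + ((cc.B : ℤ) : 𝓞 K) = eltD F hθ hD cc.WD := by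
    rw [lin_smulCoords, ← M_mul_eltD hθ hD hovX, ← M_mul_eltD hθ hD hovD] at hderX
    simp only [List.map_nil, List.prod_nil, mul_one, Int.cast_mul, Int.cast_pow, Int.cast_natCast] at hderX
    have h2' : (F.M : 𝓞 K) ^ 2 ≠ 0 := pow_ne_zero 2 hMO
    apply mul_right_injective₀ h2'
    simp only
    linear_combination hderX
  have hD0 : eltD F hθ hD cc.WD ≠ 0 := eltD_ne_zero hθ h3 hD hovD hND0
  have hq0 : ((F.fd.base.q₁ * F.fd.base.q₂ : ℕ) : 𝓞 K) ≠ 0 := by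
    exact_mod_cast Nat.mul_ne_zero hq₁.ne_zero hq₂.ne_zero
  have hM0 : eltD F hθ hD cc.WD * ((F.fd.base.q₁ * F.fd.base.q₂ : ℕ) : 𝓞 K) ≠ 0 := mul_ne_zero hD0 hq0
  have hgen := closure_tsupp_eq_top_of_dvd
    (dvd_mul_left ((F.fd.base.q₁ * F.fd.base.q₂ : ℕ) : 𝓞 K) (eltD F hθ hD cc.WD))
    (F.fd.closure_q2_eq_top_of_coreD hθ h3 hD hpr)
  have hDM : ∀ v : HeightOneSpectrum (𝓞 K), (3 : 𝓞 K) * (eltD F hθ hD cc.Wt) ^ 2 +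
      2 * ((cc.A : ℤ) : 𝓞 K) * (eltD F hθ hD cc.Wt) + ((cc.B : ℤ) : 𝓞 K) ∈ v.asIdeal →
      eltD F hθ hD cc.WD * ((F.fd.base.q₁ * F.fd.base.q₂ : ℕ) : 𝓞 K) ∈ v.asIdeal := by
    intro v hv
    rw [hderiv] at hv
    exact Ideal.mul_mem_right _ _ hv
  -- `D₀ ∉ W₁₁, W₁₂, W₂₁, W₂₂` (read on `X_D`)
  have hDW : ∀ W : HeightOneSpectrum (𝓞 K), lin hθ cc.XD.1 cc.XD.2.1 cc.XD.2.2 ∉ W.asIdeal →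
      eltD F hθ hD cc.WD ∉ W.asIdeal := fun W hX h =>
    hX (by rw [← M_mul_eltD hθ hD hovD]; exact Ideal.mul_mem_left _ _ h)
  have hDW₁₁ := hDW _ (lin_not_mem_of_invCert hθ _ (W₁₁r_asIdeal hθ h3 hR hpr) hdW11)
  have hDW₁₂ := hDW _ (lin_not_mem_of_invCert hθ _ (W₁₂r_asIdeal hθ h3 hR hpr) hdW12)
  have hDW₂₁ := hDW _ (lin_not_mem_of_invCert hθ _ (W₂₁r_asIdeal hθ h3 hR hpr) hdW21)
  have hDW₂₂ := hDW _ (lin_not_mem_of_invCert hθ _ (W₂₂r_asIdeal hθ h3 hR hpr) hdW22)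
  -- the support `T = {W₁₁, W₁₂, W₂₁, W₂₂} ∪ code primes`
  set L := cc.codes.length with hL
  let Tf : Fin (L + 4) → HeightOneSpectrum (𝓞 K) := Matrix.vecCons (F.fd.base.W₁₁r hθ h3 hR hpr)
    (Matrix.vecCons (F.fd.base.W₁₂r hθ h3 hR hpr) (Matrix.vecCons (F.fd.base.W₂₁r hθ h3 hR hpr)
      (Matrix.vecCons (F.fd.base.W₂₂r hθ h3 hR hpr) fun i => codePrimeD F hθ h3 hD hpr R₁ R₂ R₃ (cc.codes.get i))))
  have hT : ∀ w : HeightOneSpectrum (𝓞 K),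
      eltD F hθ hD cc.WD * ((F.fd.base.q₁ * F.fd.base.q₂ : ℕ) : 𝓞 K) ∈ w.asIdeal → ∃ i, Tf i = w := by
    intro w hw
    have hqw : ((F.fd.base.q₁ : ℕ) : 𝓞 K) ∈ w.asIdeal ∨ ((F.fd.base.q₂ : ℕ) : 𝓞 K) ∈ w.asIdeal →
        ∃ i, Tf i = w := fun hqw => by
      rcases hqw with h₁ | h₂
      · rcases eq_W₁₁r_or_W₁₂r hθ h3 hR hpr w h₁ with rfl | rfl
        · exact ⟨0, by simp [Tf]⟩
        · exact ⟨1, by simp [Tf]⟩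
      · rcases eq_W₂₁r_or_W₂₂r hθ h3 hR hpr w h₂ with rfl | rfl
        · exact ⟨2, by simp [Tf]⟩
        · exact ⟨3, by simp [Tf]⟩
    rcases w.isPrime.mem_or_mem hw with hD' | hq'
    · have hXv := avatar_memD hθ hD hovD w hD'
      obtain ⟨pe, hpe, hpv⟩ := exists_prime_of_memD hθ h3 hD hND0 hdn w hXv
      rcases dispatch_soundD (cc := cc) R₁ R₂ R₃ hθ h3 hD hK hpr hovD (hdnC pe hpe) w hpv hD' with
        hq'' | ⟨C, hmem, hany, hC, hw', -⟩ | ⟨i, hi0, hany, hw'⟩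
      · exact hqw hq''
      · obtain ⟨bc, hbc, hbc1⟩ := List.mem_map.mp hmem
        obtain ⟨i, hi⟩ := List.mem_iff_get.mp hbc
        refine ⟨i.succ.succ.succ.succ, HeightOneSpectrum.ext ?_⟩
        simp only [Tf, Matrix.cons_val_succ]
        rw [hi, codePrimeD, if_pos (by rw [hbc1]), show bc.1.2 = C by rw [hbc1],
          codePrimeR_asIdeal hθ h3 hR hpr hany hC, hw']
      · obtain ⟨bc, hbc, hbci⟩ := List.any_eq_true.mp hany
        rw [beq_iff_eq] at hbci
        obtain ⟨j, hj⟩ := List.mem_iff_get.mp hbc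
        refine ⟨j.succ.succ.succ.succ, ?_⟩
        simp only [Tf, Matrix.cons_val_succ]
        rw [hj, codePrimeD, if_neg (by rw [hbci]; exact hi0), hbci, hw']
    · rw [natCast_q₁q₂] at hq'
      exact hqw (w.isPrime.mem_or_mem hq')
  -- the family
  set fm := famD cc with hfm
  let W : Fin fm.length → 𝓞 K := fun j => eltD F hθ hD (fm.get j).W
  have hfam : ∀ j : Fin fm.length, famCheckD F cc (fm.get j) = true := fun j => hfamAll _ (List.get_mem _ j)
  have hW0 : ∀ j, W j ≠ 0 := fun j =>
    eltD_ne_zero hθ h3 hD (ov_of_famCheckD (hfam j)) (normFormZ_ne_of_famCheckD (hfam j))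
  have hWval : ∀ j (v : HeightOneSpectrum (𝓞 K)),
      eltD F hθ hD cc.WD * ((F.fd.base.q₁ * F.fd.base.q₂ : ℕ) : 𝓞 K) ∉ v.asIdeal →
        v.valuation K (algebraMap (𝓞 K) K (W j)) = 1 :=
    fun j v hv => valuation_eq_one_of_support _ _
      (supp_of_famCheckD R₁ R₂ R₃ hθ h3 hD hK hpr hcodes hovD (hfam j)) v hv
  obtain ⟨ρ, hlo, hhi⟩ := F.fd.base.exists_rho_of_field hθ h3 hfd
  -- independence modulo squares: the parity certificate (rows computed on `X = M x`, `M` a square)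
  have hrow : ∀ (Wp : HeightOneSpectrum (𝓞 K)) (Lf : FamEntryD → ℤ),
      (∀ j, WithZero.log (Wp.valuation K ((W j : 𝓞 K) : K)) = Lf (fm.get j)) →
      ∀ j, ((!decide ((2 : ℤ) ∣ Lf (fm.get j))) = true ↔ ¬ 2 ∣ WithZero.log (Wp.valuation K ((W j : 𝓞 K) : K))) :=
    fun Wp Lf hlog j => by rw [hlog j]; simp
  have hr₁₁ := hrow _ famL₁₁D fun j => log_W₁₁r_of_famCheckD hθ h3 hD hK hpr (hfam j)
  have hr₁₂ := hrow _ famL₁₂D fun j => log_W₁₂r_of_famCheckD hθ h3 hD hK hpr (hfam j)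
  have hr₂₁ := hrow _ famL₂₁D fun j => log_W₂₁r_of_famCheckD hθ h3 hD hK hpr (hfam j)
  have hr₂₂ := hrow _ famL₂₂D fun j => log_W₂₂r_of_famCheckD hθ h3 hD hK hpr (hfam j)
  have hind : ∀ S : Finset (Fin fm.length), IsSquare (∏ i ∈ S, algebraMap (𝓞 K) K (W i)) → S = ∅ := by
    intro S hS
    refine indep_of_parity_certificate (fun i => algebraMap (𝓞 K) K (W i)) (bitD F cc) ?_ hcert S hS
    intro k S' hS'
    have hS'' : IsSquare (∏ i ∈ S', W i) := isSquare_prod_of_isSquare_prod_coe _ hS'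
    obtain ⟨k, hk⟩ := k
    rcases k with _ | _ | _ | _ | _ | k
    · have h := even_card_of_isSquare_real ρ (fun i => algebraMap (𝓞 K) K (W i))
        (fun i => rho_ne_zero_of_famCheckD hθ ρ hlo hhi h0 hD (hfam i)) hS'
      convert h using 2
      refine Finset.filter_congr (fun i _ => ?_)
      exact sign_iff_of_famCheckD hθ ρ hlo hhi h0 hD hK (hfam i)
    · exact even_card_of_isSquare_valuation (F.fd.base.W₁₁r hθ h3 hR hpr) W hW0 _ hr₁₁ hS'
    · exact even_card_of_isSquare_valuation (F.fd.base.W₁₂r hθ h3 hR hpr) W hW0 _ hr₁₂ hS'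
    · exact even_card_of_isSquare_valuation (F.fd.base.W₂₁r hθ h3 hR hpr) W hW0 _ hr₂₁ hS'
    · exact even_card_of_isSquare_valuation (F.fd.base.W₂₂r hθ h3 hR hpr) W hW0 _ hr₂₂ hS'
    · have hk' : k < F.fd.base.chars.length := by omega
      have hch : F.fd.base.chars.getD k ((3 : ℕ), (0 : ℤ), (0 : ℤ)) ∈ F.fd.base.chars := by
        rw [List.getD_eq_getElem?_getD, List.getElem?_eq_getElem hk', Option.getD_some]
        exact List.getElem_mem hk'
      obtain ⟨h2', ψ, hψ⟩ := F.fd.base.exists_psi_of_reg hθ h3 hR hpr hch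
      haveI : Fact (F.fd.base.chars.getD k (3, 0, 0)).1.Prime := ⟨F.fd.base.char_prime hpr hch⟩
      have hSX : IsSquare (∏ i ∈ S', lin hθ (fm.get i).X.1 (fm.get i).X.2.1 (fm.get i).X.2.2) := by
        have e1 : ∀ i ∈ S', lin hθ (fm.get i).X.1 (fm.get i).X.2.1 (fm.get i).X.2.2 = (F.M : 𝓞 K) * W i :=
          fun i _ => (M_mul_eltD hθ hD (ov_of_famCheckD (hfam i))).symm
        rw [Finset.prod_congr rfl e1, Finset.prod_mul_distrib, Finset.prod_const]
        obtain ⟨z, hz⟩ := hS''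
        refine ⟨(F.r₁ : 𝓞 K) ^ S'.card * z, ?_⟩
        rw [hz]
        simp only [ClFieldCertDc.M, Nat.cast_pow]
        ring
      have h := even_card_filter_eulerBit hθ (ℓ := (F.fd.base.chars.getD k (3, 0, 0)).1) (by omega) ψ hψ
        (fun i => (fm.get i).X) (fun i => not_dvd_evalInt_of_famCheckD (hfam i) hch) hSX
      convert h using 2
      exact Finset.filter_congr (fun i _ => Iff.rfl)
  -- spanning of the `T`-units modulo squares
  have hodd : Odd (finrank ℚ K) := by rw [h3]; decide
  have hn : fm.length = NumberField.Units.rank K + 1 + (L + 4) := by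
    rw [F.fd.base.units_rank_of_field hθ h3 hfd]
    simp only [hfm, famD, List.length_append, List.length_map, hL, hhead]
    omega
  have hspan : ∀ u : K, u ≠ 0 →
      (∀ v : HeightOneSpectrum (𝓞 K),
        eltD F hθ hD cc.WD * ((F.fd.base.q₁ * F.fd.base.q₂ : ℕ) : 𝓞 K) ∉ v.asIdeal →
          v.valuation K u = 1) →
      ∃ U : Finset (Fin fm.length), IsSquare (u * ∏ j ∈ U, algebraMap (𝓞 K) K (W j)) :=
    fun u hu huT => exists_isSquare_tunit_mul_prod hodd _ Tf hT hn (fun j => algebraMap (𝓞 K) K (W j))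
      (fun j => RingOfIntegers.coe_ne_zero_iff.mpr (hW0 j)) hWval hind u hu huT
  -- the sieve is sound at rational points
  have hθQ : ∀ x : ℚ, algebraMap ℚ K x ≠ algebraMap (𝓞 K) K (eltD F hθ hD cc.Wt) :=
    ne_of_powIndep (powIndep_algebraMap hirrF' haev h3)
  have hFrel : (eltD F hθ hD cc.Wt) ^ 3 + cc.A * (eltD F hθ hD cc.Wt) ^ 2 +
      cc.B * (eltD F hθ hD cc.Wt) + cc.C = 0 := by
    apply RingOfIntegers.coe_injective
    simpa only [map_add, map_mul, map_pow, map_intCast, _root_.map_zero] using MonicCubic.theta_rel haev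
  have hadm0 : admD F cc ∅ ∅ = true := by
    simp only [admD, Bool.and_eq_true, decide_eq_true_eq, Finset.filter_empty, Finset.card_empty]
    exact ⟨⟨⟨⟨admStdQ_empty _ hQ _ _ _ _, by decide⟩, by decide⟩, by decide⟩, by decide⟩
  have hadm : ∀ x y : ℚ, y ^ 2 = x ^ 3 + cc.A * x ^ 2 + cc.B * x + cc.C →
      ∀ (T : Finset (Fin 0)) (U : Finset (Fin fm.length)),
        IsSquare ((algebraMap ℚ K x - algebraMap (𝓞 K) K (eltD F hθ hD cc.Wt)) *
          (∏ i ∈ T, algebraMap (𝓞 K) K (((fun i : Fin 0 => i.elim0 : Fin 0 → (𝓞 K)ˣ) i : (𝓞 K)ˣ) : 𝓞 K)) *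
            ∏ j ∈ U, algebraMap (𝓞 K) K (W j)) → admD F cc T U = true := by
    intro x y hxy T U hsq
    have hcof := cofactor_pos_of_disc_neg (rho_theta_root ρ haev) hdisc
    have h1 : admStd (fun i : Fin 0 => i.elim0) (famNormD F cc) (fun i : Fin 0 => i.elim0) (famSignD cc) T U =
        true :=
      admStd_sound hirrF' haev h3 ρ hcof (w := fun i : Fin 0 => algebraMap (𝓞 K) K
          (((fun i : Fin 0 => i.elim0 : Fin 0 → (𝓞 K)ˣ) i : (𝓞 K)ˣ) : 𝓞 K))
        (g := fun j => algebraMap (𝓞 K) K (W j)) (fun i => i.elim0)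
        (fun j => RingOfIntegers.coe_ne_zero_iff.mpr (hW0 j)) (fun i => i.elim0)
        (fun j => norm_eltD hθ h3 hD hK (ov_of_famCheckD (hfam j)) (dvd_of_famCheckD (hfam j)))
        (fun i => i.elim0)
        (fun j => sign_iff_of_famCheckD hθ ρ hlo hhi h0 hD hK (hfam j)) x y hxy T U hsq
    have hv := fun (Wp : HeightOneSpectrum (𝓞 K)) (hDWp : eltD F hθ hD cc.WD ∉ Wp.asIdeal) (k : ℕ)
        (hr : ∀ j, (bitRowD F.fd.base (fm.get j) k = true ↔
          ¬ 2 ∣ WithZero.log (Wp.valuation K ((W j : 𝓞 K) : K)))) =>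
      valRow_sound hFrel hθQ Wp (by rw [hderiv]; exact hDWp) hW0 (r := fun j => bitRowD F.fd.base (fm.get j) k)
        hr x y hxy T U hsq
    simp only [admD, Bool.and_eq_true]
    exact ⟨⟨⟨⟨admStdQ_of_admStd hQ h1, hv _ hDW₁₁ 1 hr₁₁⟩, hv _ hDW₁₂ 2 hr₁₂⟩, hv _ hDW₂₁ 3 hr₂₁⟩,
      hv _ hDW₂₂ 4 hr₂₂⟩
  -- the killed classes: rescale by the square `M ^ (#U + 1) = (r₁ ^ (#U + 1))²`, then `admKillsV_sound` on
  -- `(M x − X_t(θ)) · ∏_{j ∈ U} X_j(θ)` over the `X`-coordinates of the family (no units)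
  have hkill := killListCheckV_of_liteVD hlite hk
  have hadmK : ∀ x y : ℚ, y ^ 2 = x ^ 3 + cc.A * x ^ 2 + cc.B * x + cc.C →
      ∀ (T : Finset (Fin 0)) (U : Finset (Fin fm.length)),
        IsSquare ((algebraMap ℚ K x - algebraMap (𝓞 K) K (eltD F hθ hD cc.Wt)) *
          (∏ i ∈ T, algebraMap (𝓞 K) K (((fun i : Fin 0 => i.elim0 : Fin 0 → (𝓞 K)ˣ) i : (𝓞 K)ˣ) : 𝓞 K)) *
            ∏ j ∈ U, algebraMap (𝓞 K) K (W j)) → admKD F cc ks T U = true := by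
    intro x y hxy T U hsq
    have hsq' : IsSquare ((algebraMap ℚ K ((F.M : ℚ) * x) -
        algebraMap (𝓞 K) K (lin hθ cc.Xt.1 cc.Xt.2.1 cc.Xt.2.2)) *
          (∏ i ∈ T, algebraMap (𝓞 K) K (((fun i : Fin 0 => i.elim0 : Fin 0 → (𝓞 K)ˣ) i : (𝓞 K)ˣ) : 𝓞 K)) *
            ∏ j ∈ U, algebraMap (𝓞 K) K (lin hθ (fm.get j).X.1 (fm.get j).X.2.1 (fm.get j).X.2.2)) := by
      have e0 : algebraMap ℚ K ((F.M : ℚ) * x) - algebraMap (𝓞 K) K (lin hθ cc.Xt.1 cc.Xt.2.1 cc.Xt.2.2) =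
          (F.M : K) * (algebraMap ℚ K x - algebraMap (𝓞 K) K (eltD F hθ hD cc.Wt)) := by
        rw [mul_sub, hXe, map_mul, map_natCast]
      have e1 : ∀ j ∈ U, algebraMap (𝓞 K) K (lin hθ (fm.get j).X.1 (fm.get j).X.2.1 (fm.get j).X.2.2) =
          (F.M : K) * algebraMap (𝓞 K) K (W j) :=
        fun j _ => (M_mul_eltD_coe hθ hD (ov_of_famCheckD (hfam j))).symm
      rw [e0, Finset.prod_congr rfl e1, Finset.prod_mul_distrib, Finset.prod_const]
      obtain ⟨w, hw⟩ := hsq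
      refine ⟨(F.r₁ : K) ^ (U.card + 1) * w, ?_⟩
      calc (F.M : K) * (algebraMap ℚ K x - algebraMap (𝓞 K) K (eltD F hθ hD cc.Wt)) *
            (∏ i ∈ T, algebraMap (𝓞 K) K (((fun i : Fin 0 => i.elim0 : Fin 0 → (𝓞 K)ˣ) i : (𝓞 K)ˣ) : 𝓞 K)) *
              ((F.M : K) ^ U.card * ∏ j ∈ U, algebraMap (𝓞 K) K (W j))
          = ((F.M : K) * (F.M : K) ^ U.card) *
              ((algebraMap ℚ K x - algebraMap (𝓞 K) K (eltD F hθ hD cc.Wt)) *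
                (∏ i ∈ T, algebraMap (𝓞 K) K
                  (((fun i : Fin 0 => i.elim0 : Fin 0 → (𝓞 K)ˣ) i : (𝓞 K)ˣ) : 𝓞 K)) *
                  ∏ j ∈ U, algebraMap (𝓞 K) K (W j)) := by ring
        _ = ((F.r₁ : K) ^ (U.card + 1)) ^ 2 * (w * w) := by rw [M_mul_pow_eq_sq, hw]
        _ = (F.r₁ : K) ^ (U.card + 1) * w * ((F.r₁ : K) ^ (U.card + 1) * w) := by ring
    exact admKillsV_sound hirr hθ h3 cc.Xt.1
      (u := fun i : Fin 0 => (((fun i : Fin 0 => i.elim0 : Fin 0 → (𝓞 K)ˣ) i : (𝓞 K)ˣ) : 𝓞 K))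
      (fun j => lin hθ (fm.get j).X.1 (fm.get j).X.2.1 (fm.get j).X.2.2)
      (cu := noUnitCoords) (cg := famCoordsD cc) (fun i => i.elim0) (fun j => rfl) hkill
      (killValid_entries_of_killValidCD hk) (hadm x y hxy T U hsq) ((F.M : ℚ) * x) hsq'
  exact mordellWeilRank_le_of_coverSet_cl_lt (A := cc.A) (B := cc.B) (C := cc.C)
    (⟨0, cc.A, 0, cc.B, cc.C⟩ : WeierstrassCurve ℚ) rfl rfl rfl rfl rfl hirrF' haev h3 hM0 hgen hDM hW0 hspan
    (Wu := fun i : Fin 0 => i.elim0) (adm := admKD F cc ks)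
    (admKills_empty hadm0 (noTrivial_of_liteVD hlite)) hadmK (s' := r) hcount

/-- **`rank E(ℚ) = r`** from the checked dyadic-root-view two-prime field record, a checked `ω`-curve record with a
kill list, the validity of its kills and the tree's lower bound. [cite: CremonaAlgorithms1997, §3.6] -/
theorem rank_eq_of_checkCD (r : ℕ) (F : ClFieldCertDc)
    (hθ : aeval θ (MonicCubic.poly F.fd.base.a F.fd.base.b F.fd.base.c) = 0) (h3 : finrank ℚ K = 3)
    (h2 : F.check2 = true) (hpr : F.fd.base.primeList.Forall Nat.Prime) (cc : ClCurveCertD) (ks : List ClKill)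
    (hc : checkCD F cc r ks = true) (hk : KillValidCD F cc ks)
    (hlow : r ≤ (((⟨0, cc.A, 0, cc.B, cc.C⟩ : WeierstrassCurve ℤ)).map (Int.castRingHom ℚ)).mordellWeilRank) :
    (((⟨0, cc.A, 0, cc.B, cc.C⟩ : WeierstrassCurve ℤ)).map (Int.castRingHom ℚ)).mordellWeilRank = r := by
  have hmap : ((⟨0, cc.A, 0, cc.B, cc.C⟩ : WeierstrassCurve ℤ)).map (Int.castRingHom ℚ) =
      (⟨0, cc.A, 0, cc.B, cc.C⟩ : WeierstrassCurve ℚ) := by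
    ext <;> simp [WeierstrassCurve.map]
  rw [hmap] at hlow ⊢
  exact le_antisymm (rank_le_of_checkCD r F hθ h3 h2 hpr cc ks hc hk) hlow

end Sound

end Summit.BirchSwinnertonDyer.BirchSwinnertonDyer.Rank2Observatory.TwoDescCl
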